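import Summits.AtomisticToContinuum.Crystallization.Theorems.PhononStability.Negative.Mirror

/-!
# Route `ExcessDecayLiouville`: linearisation of the Lennard-Jones pair force

Step (a) of the excess-decay argument for item `ExcessDecay` (stmt-AtomisticToContinuum-9334) and of any
perturbative treatment of `HcpLiouville`: the pair force `φ′(v) = (V′(|v|)/|v|)·v` (the summand of the
route's `Equil`) is, because `V_LJ` depends on `|v|²` only, the POLYNOMIAL-IN-`v` expression
`h(|v|²)·v` with `h(x) = −x⁻⁷ + x⁻⁴`; its differential at a bond `e` is the force-constant map
`K(e)w = h(|e|²)·w + 2⟪e,w⟫ h′(|e|²)·e`, whose quadratic form is the route's `Hess` (`inner_forceConst_eq_Hess₀`),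
and the second-order Taylor remainder is explicit:

* `ljForce_eq_smul` : `(V′(|v|)/|v|)·v = h(|v|²)·v` (`v ≠ 0`);
* `inner_forceConst_eq_Hess₀` : `⟪h(|e|²)w + (2⟪e,w⟫h′(|e|²))e, w⟫ = Hess₀ e w` (`e ≠ 0`);
* `ljForce_taylor_identity` : `φ′(e+w) − φ′(e) − K(e)w = T·e + h′(x)|w|²·e + (h(y) − h(x))·w` with
  `x = |e|²`, `y = |e+w|²`, `T = h(y) − h(x) − h′(x)(y−x)`;
* `abs_h_sub_h_le`, `abs_taylor_h_le` : mean-value bounds for `h` on `[m, ∞)`;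
* `norm_ljForce_linearisation_le` : for `|e| ≥ 9/10`, `|w| ≤ 1/10`,
  `‖φ′(e+w) − φ′(e) − K(e)w‖ ≤ 6000 · |e|⁻⁹ · |w|²` (crude but summable constant: the remainder of the
  linearised force equation is `O(ε²)` uniformly, with an `|e|⁻⁹` tail over the bonds).

All `[folklore]`; helper lemmas, nothing here closes an item.
-/

noncomputable section

namespace Summit.AtomisticToContinuum.Crystallization.Theorems.ExcessDecayLiouville

open scoped BigOperators Topology InnerProductSpace RealInnerProductSpace
open Literature.MathematicalPhysics.StatisticalMechanics
open Summit.AtomisticToContinuum.Crystallization.Theorems.PhononStabilityNegative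

/-! ## The scalar profile `h(x) = −x⁻⁷ + x⁻⁴` and its derivatives -/

/-- `h(x) = −x⁻⁷ + x⁻⁴` has derivative `h′(x) = 7x⁻⁸ − 4x⁻⁵` (`x ≠ 0`). [folklore] -/
theorem hasDerivAt_ljProfile {x : ℝ} (hx : x ≠ 0) :
    HasDerivAt (fun y : ℝ => -(y⁻¹) ^ 7 + (y⁻¹) ^ 4) (7 * (x⁻¹) ^ 8 - 4 * (x⁻¹) ^ 5) x := by
  have h1 : HasDerivAt (fun y : ℝ => y⁻¹) (-(x ^ 2)⁻¹) x := hasDerivAt_inv hx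
  refine ((h1.pow 7).neg.add (h1.pow 4)).congr_deriv ?_
  rw [← inv_pow]
  ring

/-- `h′(x) = 7x⁻⁸ − 4x⁻⁵` has derivative `h″(x) = −56x⁻⁹ + 20x⁻⁶` (`x ≠ 0`). [folklore] -/
theorem hasDerivAt_ljProfile' {x : ℝ} (hx : x ≠ 0) :
    HasDerivAt (fun y : ℝ => 7 * (y⁻¹) ^ 8 - 4 * (y⁻¹) ^ 5) (-56 * (x⁻¹) ^ 9 + 20 * (x⁻¹) ^ 6) x := by
  have h1 : HasDerivAt (fun y : ℝ => y⁻¹) (-(x ^ 2)⁻¹) x := hasDerivAt_inv hx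
  refine (((h1.pow 8).const_mul 7).sub ((h1.pow 5).const_mul 4)).congr_deriv ?_
  rw [← inv_pow]
  ring

/-- **Mean-value bound for `h`** on `[m, ∞)`, `m > 0`: `|h(y) − h(x)| ≤ (7m⁻⁸ + 4m⁻⁵)|y − x|`. [folklore] -/
theorem abs_h_sub_h_le {m x y : ℝ} (hm : 0 < m) (hx : m ≤ x) (hy : m ≤ y) :
    |(-(y⁻¹) ^ 7 + (y⁻¹) ^ 4) - (-(x⁻¹) ^ 7 + (x⁻¹) ^ 4)| ≤ (7 * (m⁻¹) ^ 8 + 4 * (m⁻¹) ^ 5) * |y - x| := by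
  have hderiv : ∀ z ∈ Set.Ici m, HasDerivWithinAt (fun y : ℝ => -(y⁻¹) ^ 7 + (y⁻¹) ^ 4)
      (7 * (z⁻¹) ^ 8 - 4 * (z⁻¹) ^ 5) (Set.Ici m) z :=
    fun z hz => (hasDerivAt_ljProfile (hm.trans_le hz).ne').hasDerivWithinAt
  have hbound : ∀ z ∈ Set.Ici m, ‖7 * (z⁻¹) ^ 8 - 4 * (z⁻¹) ^ 5‖ ≤ 7 * (m⁻¹) ^ 8 + 4 * (m⁻¹) ^ 5 := by
    intro z hz
    have hz0 : 0 < z := hm.trans_le hz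
    have hzi : z⁻¹ ≤ m⁻¹ := inv_anti₀ hm hz
    have hzi0 : 0 ≤ z⁻¹ := inv_nonneg.2 hz0.le
    have h8 : (z⁻¹) ^ 8 ≤ (m⁻¹) ^ 8 := pow_le_pow_left₀ hzi0 hzi 8
    have h5 : (z⁻¹) ^ 5 ≤ (m⁻¹) ^ 5 := pow_le_pow_left₀ hzi0 hzi 5
    rw [Real.norm_eq_abs]
    refine abs_le.2 ⟨?_, ?_⟩ <;> nlinarith [pow_nonneg hzi0 8, pow_nonneg hzi0 5]
  have := (convex_Ici m).norm_image_sub_le_of_norm_hasDerivWithin_le hderiv hbound hx hy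
  simpa only [Real.norm_eq_abs] using this

/-- **Mean-value bound for `h′`** on `[m, ∞)`: `|h′(y) − h′(x)| ≤ (56m⁻⁹ + 20m⁻⁶)|y − x|`. [folklore] -/
theorem abs_h'_sub_h'_le {m x y : ℝ} (hm : 0 < m) (hx : m ≤ x) (hy : m ≤ y) :
    |(7 * (y⁻¹) ^ 8 - 4 * (y⁻¹) ^ 5) - (7 * (x⁻¹) ^ 8 - 4 * (x⁻¹) ^ 5)| ≤
      (56 * (m⁻¹) ^ 9 + 20 * (m⁻¹) ^ 6) * |y - x| := by
  have hderiv : ∀ z ∈ Set.Ici m, HasDerivWithinAt (fun y : ℝ => 7 * (y⁻¹) ^ 8 - 4 * (y⁻¹) ^ 5)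
      (-56 * (z⁻¹) ^ 9 + 20 * (z⁻¹) ^ 6) (Set.Ici m) z :=
    fun z hz => (hasDerivAt_ljProfile' (hm.trans_le hz).ne').hasDerivWithinAt
  have hbound : ∀ z ∈ Set.Ici m, ‖-56 * (z⁻¹) ^ 9 + 20 * (z⁻¹) ^ 6‖ ≤ 56 * (m⁻¹) ^ 9 + 20 * (m⁻¹) ^ 6 := by
    intro z hz
    have hz0 : 0 < z := hm.trans_le hz
    have hzi : z⁻¹ ≤ m⁻¹ := inv_anti₀ hm hz
    have hzi0 : 0 ≤ z⁻¹ := inv_nonneg.2 hz0.le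
    have h9 : (z⁻¹) ^ 9 ≤ (m⁻¹) ^ 9 := pow_le_pow_left₀ hzi0 hzi 9
    have h6 : (z⁻¹) ^ 6 ≤ (m⁻¹) ^ 6 := pow_le_pow_left₀ hzi0 hzi 6
    rw [Real.norm_eq_abs]
    refine abs_le.2 ⟨?_, ?_⟩ <;> nlinarith [pow_nonneg hzi0 9, pow_nonneg hzi0 6]
  have := (convex_Ici m).norm_image_sub_le_of_norm_hasDerivWithin_le hderiv hbound hx hy
  simpa only [Real.norm_eq_abs] using this

/-- **Second-order Taylor bound for `h`** on `[m, ∞)`: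
`|h(y) − h(x) − h′(x)(y − x)| ≤ (56m⁻⁹ + 20m⁻⁶)(y − x)²` (mean value applied to `ξ ↦ h(ξ) − h′(x)ξ`).
[folklore] -/
theorem abs_taylor_h_le {m x y : ℝ} (hm : 0 < m) (hx : m ≤ x) (hy : m ≤ y) :
    |(-(y⁻¹) ^ 7 + (y⁻¹) ^ 4) - (-(x⁻¹) ^ 7 + (x⁻¹) ^ 4) - (7 * (x⁻¹) ^ 8 - 4 * (x⁻¹) ^ 5) * (y - x)| ≤
      (56 * (m⁻¹) ^ 9 + 20 * (m⁻¹) ^ 6) * (y - x) ^ 2 := by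
  -- work on the segment between x and y, inside [m, ∞)
  set a := min x y with ha
  set b := max x y with hb
  have hma : m ≤ a := le_min hx hy
  have hseg : ∀ z ∈ Set.Icc a b, |z - x| ≤ |y - x| := by
    intro z hz
    rcases le_total x y with hxy | hxy
    · have h1 : a = x := by rw [ha, min_eq_left hxy]
      have h2 : b = y := by rw [hb, max_eq_right hxy]
      rw [h1, h2] at hz
      rw [abs_of_nonneg (by linarith [hz.1]), abs_of_nonneg (by linarith)]
      linarith [hz.2]
    · have h1 : a = y := by rw [ha, min_eq_right hxy]
      have h2 : b = x := by rw [hb, max_eq_left hxy]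
      rw [h1, h2] at hz
      rw [abs_of_nonpos (by linarith [hz.2]), abs_of_nonpos (by linarith)]
      linarith [hz.1]
  set L := 56 * (m⁻¹) ^ 9 + 20 * (m⁻¹) ^ 6 with hL
  have hL0 : 0 ≤ L := by positivity
  -- k(ξ) = h(ξ) − h′(x) ξ has derivative h′(ξ) − h′(x), bounded by L|y − x| on the segment
  have hderiv : ∀ z ∈ Set.Icc a b, HasDerivWithinAt
      (fun ξ : ℝ => (-(ξ⁻¹) ^ 7 + (ξ⁻¹) ^ 4) - (7 * (x⁻¹) ^ 8 - 4 * (x⁻¹) ^ 5) * ξ)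
      ((7 * (z⁻¹) ^ 8 - 4 * (z⁻¹) ^ 5) - (7 * (x⁻¹) ^ 8 - 4 * (x⁻¹) ^ 5)) (Set.Icc a b) z := by
    intro z hz
    have hz0 : z ≠ 0 := (hm.trans_le (hma.trans hz.1)).ne'
    have h1 := hasDerivAt_ljProfile hz0
    have h2 : HasDerivAt (fun ξ : ℝ => (7 * (x⁻¹) ^ 8 - 4 * (x⁻¹) ^ 5) * ξ)
        (7 * (x⁻¹) ^ 8 - 4 * (x⁻¹) ^ 5) z := by
      simpa only [mul_one, id] using (hasDerivAt_id z).const_mul (7 * (x⁻¹) ^ 8 - 4 * (x⁻¹) ^ 5)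
    exact (h1.sub h2).hasDerivWithinAt
  have hbound : ∀ z ∈ Set.Icc a b,
      ‖(7 * (z⁻¹) ^ 8 - 4 * (z⁻¹) ^ 5) - (7 * (x⁻¹) ^ 8 - 4 * (x⁻¹) ^ 5)‖ ≤ L * |y - x| := by
    intro z hz
    rw [Real.norm_eq_abs]
    have h1 := abs_h'_sub_h'_le hm hx (hma.trans hz.1)
    exact h1.trans (mul_le_mul_of_nonneg_left (hseg z hz) hL0)
  have hxs : x ∈ Set.Icc a b := ⟨min_le_left _ _, le_max_left _ _⟩
  have hys : y ∈ Set.Icc a b := ⟨min_le_right _ _, le_max_right _ _⟩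
  have hmv := (convex_Icc a b).norm_image_sub_le_of_norm_hasDerivWithin_le hderiv hbound hxs hys
  rw [Real.norm_eq_abs, Real.norm_eq_abs] at hmv
  have hid : (-(y⁻¹) ^ 7 + (y⁻¹) ^ 4) - (7 * (x⁻¹) ^ 8 - 4 * (x⁻¹) ^ 5) * y -
      ((-(x⁻¹) ^ 7 + (x⁻¹) ^ 4) - (7 * (x⁻¹) ^ 8 - 4 * (x⁻¹) ^ 5) * x) =
      (-(y⁻¹) ^ 7 + (y⁻¹) ^ 4) - (-(x⁻¹) ^ 7 + (x⁻¹) ^ 4) - (7 * (x⁻¹) ^ 8 - 4 * (x⁻¹) ^ 5) * (y - x) := by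
    ring
  rw [hid] at hmv
  calc _ ≤ L * |y - x| * |y - x| := hmv
    _ = L * (y - x) ^ 2 := by rw [mul_assoc, ← abs_mul, ← sq, abs_of_nonneg (sq_nonneg _)]

/-! ## The pair force and the force-constant map in terms of `h` -/

/-- **The LJ pair force is `h(|v|²)·v`**: `(V′(|v|)/|v|)·v = (−(|v|²)⁻⁷ + (|v|²)⁻⁴)·v` for `v ≠ 0`.
[folklore] -/
theorem ljForce_eq_smul {v : EuclideanSpace ℝ (Fin 3)} (hv : v ≠ 0) :
    (deriv lennardJones ‖v‖ / ‖v‖) • v = (-((‖v‖ ^ 2)⁻¹) ^ 7 + ((‖v‖ ^ 2)⁻¹) ^ 4) • v := by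
  have hn : ‖v‖ ≠ 0 := norm_ne_zero_iff.2 hv
  congr 1
  rw [deriv_lennardJones hn]
  field_simp

/-- **The quadratic form of the force-constant map is the route's `Hess`**:
`⟪h(x)w + (2⟪e,w⟫h′(x))e, w⟫ = Hess₀ e w`, `x = |e|²`, `e ≠ 0`. [folklore] -/
theorem inner_forceConst_eq_Hess₀ {e : EuclideanSpace ℝ (Fin 3)} (he : e ≠ 0) (w : EuclideanSpace ℝ (Fin 3)) :
    ⟪(-((‖e‖ ^ 2)⁻¹) ^ 7 + ((‖e‖ ^ 2)⁻¹) ^ 4) • w +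
        (2 * ⟪e, w⟫ * (7 * ((‖e‖ ^ 2)⁻¹) ^ 8 - 4 * ((‖e‖ ^ 2)⁻¹) ^ 5)) • e, w⟫ = Hess₀ e w := by
  have hn : ‖e‖ ≠ 0 := norm_ne_zero_iff.2 he
  rw [Hess₀, deriv_deriv_lennardJones hn, deriv_lennardJones hn]
  rw [inner_add_left, real_inner_smul_left, real_inner_smul_left, real_inner_self_eq_norm_sq]
  field_simp
  ring

/-- **Taylor identity for the pair force.**  With `x = |e|²`, `y = |e + w|²` (so `y − x = 2⟪e,w⟫ + |w|²`):
`h(y)(e+w) − h(x)e − [h(x)w + 2⟪e,w⟫h′(x)e] = (h(y) − h(x) − h′(x)(y−x))·e + (h′(x)|w|²)·e + (h(y) − h(x))·w`.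
[folklore] -/
theorem ljForce_taylor_identity (e w : EuclideanSpace ℝ (Fin 3)) (hh hh' : ℝ → ℝ) :
    hh (‖e + w‖ ^ 2) • (e + w) - hh (‖e‖ ^ 2) • e -
        (hh (‖e‖ ^ 2) • w + (2 * ⟪e, w⟫ * hh' (‖e‖ ^ 2)) • e) =
      (hh (‖e + w‖ ^ 2) - hh (‖e‖ ^ 2) - hh' (‖e‖ ^ 2) * (‖e + w‖ ^ 2 - ‖e‖ ^ 2)) • e +
        (hh' (‖e‖ ^ 2) * ‖w‖ ^ 2) • e + (hh (‖e + w‖ ^ 2) - hh (‖e‖ ^ 2)) • w := by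
  have hy : ‖e + w‖ ^ 2 - ‖e‖ ^ 2 = 2 * ⟪e, w⟫ + ‖w‖ ^ 2 := by
    rw [norm_add_sq_real]; ring
  rw [hy]
  module

/-! ## The remainder estimate -/

/-- Geometry of a perturbed bond: for `|e| ≥ 9/10` and `|w| ≤ 1/10`,
`(79/100)|e|² ≤ |e + w|²` and `| |e+w|² − |e|² | ≤ (53/25)|e|·|w|`. [folklore] -/
theorem bond_perturb_bounds {e w : EuclideanSpace ℝ (Fin 3)} (he : 9 / 10 ≤ ‖e‖) (hw : ‖w‖ ≤ 1 / 10) :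
    79 / 100 * ‖e‖ ^ 2 ≤ ‖e + w‖ ^ 2 ∧ |‖e + w‖ ^ 2 - ‖e‖ ^ 2| ≤ 53 / 25 * ‖e‖ * ‖w‖ := by
  have hw0 : 0 ≤ ‖w‖ := norm_nonneg w
  have hwe : ‖w‖ ≤ ‖e‖ / 9 := by linarith
  have hcs : |⟪e, w⟫| ≤ ‖e‖ * ‖w‖ := abs_real_inner_le_norm e w
  have hsq : ‖e + w‖ ^ 2 = ‖e‖ ^ 2 + 2 * ⟪e, w⟫ + ‖w‖ ^ 2 := norm_add_sq_real e w
  constructor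
  · rw [hsq]
    have := (abs_le.1 hcs).1
    nlinarith
  · rw [hsq]
    have h1 := (abs_le.1 hcs).1
    have h2 := (abs_le.1 hcs).2
    rw [abs_le]
    constructor <;> nlinarith

/-- The scalar bookkeeping behind `norm_ljForce_linearisation_le`: with `E = |e| ≥ 9/10`, `W = |w| ≥ 0`,
`x = E²`, `y = |e+w|²`, `|y − x| ≤ (53/25)EW`, the three remainder coefficients add up to
`≤ 6000 E⁻⁹ W²`. [folklore] -/
theorem linearisation_scalar_bound {E W y : ℝ} (hE : 9 / 10 ≤ E) (hW0 : 0 ≤ W)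
    (hdiff : |y - E ^ 2| ≤ 53 / 25 * E * W) :
    (56 * ((79 / 100 * E ^ 2)⁻¹) ^ 9 + 20 * ((79 / 100 * E ^ 2)⁻¹) ^ 6) * (y - E ^ 2) ^ 2 * E +
        (7 * ((E ^ 2)⁻¹) ^ 8 + 4 * ((E ^ 2)⁻¹) ^ 5) * W ^ 2 * E +
        (7 * ((79 / 100 * E ^ 2)⁻¹) ^ 8 + 4 * ((79 / 100 * E ^ 2)⁻¹) ^ 5) * |y - E ^ 2| * W ≤
      6000 * (E⁻¹) ^ 9 * W ^ 2 := by
  have hE0 : 0 < E := by linarith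
  have hmi : (79 / 100 * E ^ 2)⁻¹ = (100 / 79) * (E⁻¹) ^ 2 := by rw [mul_inv, inv_pow]; norm_num
  have hxi : (E ^ 2)⁻¹ = (E⁻¹) ^ 2 := by rw [inv_pow]
  rw [hmi, hxi]
  set u := E⁻¹ with hu
  have hu0 : 0 < u := inv_pos.2 hE0
  have hue : u * E = 1 := by rw [hu, inv_mul_cancel₀ hE0.ne']
  have hei : u ≤ 10 / 9 := by
    rw [hu, inv_le_comm₀ hE0 (by norm_num)]; linarith
  have hu15 : u ^ 15 ≤ (10 / 9) ^ 6 * u ^ 9 := by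
    have : u ^ 6 ≤ (10 / 9) ^ 6 := pow_le_pow_left₀ hu0.le hei 6
    nlinarith [pow_pos hu0 9]
  have hW2 : 0 ≤ W ^ 2 := sq_nonneg _
  have hyx2 : (y - E ^ 2) ^ 2 ≤ (53 / 25 * E * W) ^ 2 := by
    rw [← sq_abs]; exact pow_le_pow_left₀ (abs_nonneg _) hdiff 2
  -- powers of u against powers of E
  have e18 : ((100 / 79 : ℝ) * u ^ 2) ^ 9 * E ^ 3 = (100 / 79) ^ 9 * u ^ 15 := by
    have : u ^ 18 * E ^ 3 = u ^ 15 * (u * E) ^ 3 := by ring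
    rw [mul_pow, ← pow_mul, show 2 * 9 = 18 by norm_num, mul_assoc, this, hue, one_pow, mul_one]
  have e12 : ((100 / 79 : ℝ) * u ^ 2) ^ 6 * E ^ 3 = (100 / 79) ^ 6 * u ^ 9 := by
    have : u ^ 12 * E ^ 3 = u ^ 9 * (u * E) ^ 3 := by ring
    rw [mul_pow, ← pow_mul, show 2 * 6 = 12 by norm_num, mul_assoc, this, hue, one_pow, mul_one]
  have e16 : (u ^ 2) ^ 8 * E = u ^ 15 := by
    have : u ^ 16 * E = u ^ 15 * (u * E) := by ring
    rw [← pow_mul, show 2 * 8 = 16 by norm_num, this, hue, mul_one]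
  have e10 : (u ^ 2) ^ 5 * E = u ^ 9 := by
    have : u ^ 10 * E = u ^ 9 * (u * E) := by ring
    rw [← pow_mul, show 2 * 5 = 10 by norm_num, this, hue, mul_one]
  have e16' : ((100 / 79 : ℝ) * u ^ 2) ^ 8 * E = (100 / 79) ^ 8 * u ^ 15 := by
    rw [mul_pow, mul_assoc, e16]
  have e10' : ((100 / 79 : ℝ) * u ^ 2) ^ 5 * E = (100 / 79) ^ 5 * u ^ 9 := by
    rw [mul_pow, mul_assoc, e10]
  -- term A
  have hA : (56 * ((100 / 79) * u ^ 2) ^ 9 + 20 * ((100 / 79) * u ^ 2) ^ 6) * (y - E ^ 2) ^ 2 * E ≤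
      5000 * u ^ 9 * W ^ 2 := by
    calc (56 * ((100 / 79) * u ^ 2) ^ 9 + 20 * ((100 / 79) * u ^ 2) ^ 6) * (y - E ^ 2) ^ 2 * E
        ≤ (56 * ((100 / 79) * u ^ 2) ^ 9 + 20 * ((100 / 79) * u ^ 2) ^ 6) * (53 / 25 * E * W) ^ 2 * E := by
          gcongr
      _ = (53 / 25) ^ 2 * W ^ 2 * (56 * (((100 / 79 : ℝ) * u ^ 2) ^ 9 * E ^ 3) +
            20 * (((100 / 79 : ℝ) * u ^ 2) ^ 6 * E ^ 3)) := by ring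
      _ = (53 / 25) ^ 2 * W ^ 2 * (56 * ((100 / 79) ^ 9 * u ^ 15) + 20 * ((100 / 79) ^ 6 * u ^ 9)) := by
          rw [e18, e12]
      _ ≤ (53 / 25) ^ 2 * W ^ 2 * (56 * ((100 / 79) ^ 9 * ((10 / 9) ^ 6 * u ^ 9)) +
            20 * ((100 / 79) ^ 6 * u ^ 9)) := by gcongr
      _ = ((53 / 25) ^ 2 * (56 * (100 / 79) ^ 9 * (10 / 9) ^ 6 + 20 * (100 / 79) ^ 6)) * u ^ 9 * W ^ 2 := by
          ring
      _ ≤ 5000 * u ^ 9 * W ^ 2 := by gcongr; norm_num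
  -- term B
  have hB : (7 * (u ^ 2) ^ 8 + 4 * (u ^ 2) ^ 5) * W ^ 2 * E ≤ 20 * u ^ 9 * W ^ 2 := by
    calc (7 * (u ^ 2) ^ 8 + 4 * (u ^ 2) ^ 5) * W ^ 2 * E
        = W ^ 2 * (7 * ((u ^ 2) ^ 8 * E) + 4 * ((u ^ 2) ^ 5 * E)) := by ring
      _ = W ^ 2 * (7 * u ^ 15 + 4 * u ^ 9) := by rw [e16, e10]
      _ ≤ W ^ 2 * (7 * ((10 / 9) ^ 6 * u ^ 9) + 4 * u ^ 9) := by gcongr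
      _ = (7 * (10 / 9) ^ 6 + 4) * u ^ 9 * W ^ 2 := by ring
      _ ≤ 20 * u ^ 9 * W ^ 2 := by gcongr; norm_num
  -- term C
  have hC : (7 * ((100 / 79) * u ^ 2) ^ 8 + 4 * ((100 / 79) * u ^ 2) ^ 5) * |y - E ^ 2| * W ≤
      800 * u ^ 9 * W ^ 2 := by
    calc (7 * ((100 / 79) * u ^ 2) ^ 8 + 4 * ((100 / 79) * u ^ 2) ^ 5) * |y - E ^ 2| * W
        ≤ (7 * ((100 / 79) * u ^ 2) ^ 8 + 4 * ((100 / 79) * u ^ 2) ^ 5) * (53 / 25 * E * W) * W := by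
          gcongr
      _ = 53 / 25 * W ^ 2 * (7 * (((100 / 79 : ℝ) * u ^ 2) ^ 8 * E) +
            4 * (((100 / 79 : ℝ) * u ^ 2) ^ 5 * E)) := by ring
      _ = 53 / 25 * W ^ 2 * (7 * ((100 / 79) ^ 8 * u ^ 15) + 4 * ((100 / 79) ^ 5 * u ^ 9)) := by
          rw [e16', e10']
      _ ≤ 53 / 25 * W ^ 2 * (7 * ((100 / 79) ^ 8 * ((10 / 9) ^ 6 * u ^ 9)) + 4 * ((100 / 79) ^ 5 * u ^ 9)) := by
          gcongr
      _ = (53 / 25 * (7 * (100 / 79) ^ 8 * (10 / 9) ^ 6 + 4 * (100 / 79) ^ 5)) * u ^ 9 * W ^ 2 := by ring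
      _ ≤ 800 * u ^ 9 * W ^ 2 := by gcongr; norm_num
  have hpos : 0 ≤ u ^ 9 * W ^ 2 := by positivity
  nlinarith [hA, hB, hC, hpos]

/-- **Linearisation of the pair force with explicit remainder**: for a bond `e` with `|e| ≥ 9/10` and a
relative displacement `w` with `|w| ≤ 1/10`,
`‖h(|e+w|²)(e+w) − h(|e|²)e − (h(|e|²)w + 2⟪e,w⟫h′(|e|²)e)‖ ≤ 6000 · |e|⁻⁹ · |w|²`
(`h(x) = −x⁻⁷ + x⁻⁴`; by `ljForce_eq_smul` the first two terms are the pair forces `φ′(e+w)`, `φ′(e)`).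
[folklore] -/
theorem norm_ljForce_linearisation_le {e w : EuclideanSpace ℝ (Fin 3)} (he : 9 / 10 ≤ ‖e‖)
    (hw : ‖w‖ ≤ 1 / 10) :
    ‖(-((‖e + w‖ ^ 2)⁻¹) ^ 7 + ((‖e + w‖ ^ 2)⁻¹) ^ 4) • (e + w) -
        (-((‖e‖ ^ 2)⁻¹) ^ 7 + ((‖e‖ ^ 2)⁻¹) ^ 4) • e -
        ((-((‖e‖ ^ 2)⁻¹) ^ 7 + ((‖e‖ ^ 2)⁻¹) ^ 4) • w +
          (2 * ⟪e, w⟫ * (7 * ((‖e‖ ^ 2)⁻¹) ^ 8 - 4 * ((‖e‖ ^ 2)⁻¹) ^ 5)) • e)‖ ≤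
      6000 * (‖e‖⁻¹) ^ 9 * ‖w‖ ^ 2 := by
  have hid := ljForce_taylor_identity e w (fun y => -(y⁻¹) ^ 7 + (y⁻¹) ^ 4)
    (fun y => 7 * (y⁻¹) ^ 8 - 4 * (y⁻¹) ^ 5)
  rw [hid]
  have he0 : 0 < ‖e‖ := by linarith
  have hx0 : 0 < ‖e‖ ^ 2 := by positivity
  obtain ⟨hyx, hdiff⟩ := bond_perturb_bounds he hw
  have hm0 : 0 < 79 / 100 * ‖e‖ ^ 2 := by positivity
  have hmx : 79 / 100 * ‖e‖ ^ 2 ≤ ‖e‖ ^ 2 := by nlinarith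
  have hT := abs_taylor_h_le hm0 hmx hyx
  have hD := abs_h_sub_h_le hm0 hmx hyx
  have hh'x : |7 * ((‖e‖ ^ 2)⁻¹) ^ 8 - 4 * ((‖e‖ ^ 2)⁻¹) ^ 5| ≤
      7 * ((‖e‖ ^ 2)⁻¹) ^ 8 + 4 * ((‖e‖ ^ 2)⁻¹) ^ 5 := by
    have h8 : 0 ≤ ((‖e‖ ^ 2)⁻¹) ^ 8 := by positivity
    have h5 : 0 ≤ ((‖e‖ ^ 2)⁻¹) ^ 5 := by positivity
    exact abs_le.2 ⟨by nlinarith, by nlinarith⟩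
  have hn1 : ‖((-((‖e + w‖ ^ 2)⁻¹) ^ 7 + ((‖e + w‖ ^ 2)⁻¹) ^ 4) - (-((‖e‖ ^ 2)⁻¹) ^ 7 + ((‖e‖ ^ 2)⁻¹) ^ 4) -
      (7 * ((‖e‖ ^ 2)⁻¹) ^ 8 - 4 * ((‖e‖ ^ 2)⁻¹) ^ 5) * (‖e + w‖ ^ 2 - ‖e‖ ^ 2)) • e‖ ≤
      (56 * ((79 / 100 * ‖e‖ ^ 2)⁻¹) ^ 9 + 20 * ((79 / 100 * ‖e‖ ^ 2)⁻¹) ^ 6) *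
        (‖e + w‖ ^ 2 - ‖e‖ ^ 2) ^ 2 * ‖e‖ := by
    rw [norm_smul, Real.norm_eq_abs]
    exact mul_le_mul_of_nonneg_right hT (norm_nonneg _)
  have hn2 : ‖((7 * ((‖e‖ ^ 2)⁻¹) ^ 8 - 4 * ((‖e‖ ^ 2)⁻¹) ^ 5) * ‖w‖ ^ 2) • e‖ ≤
      (7 * ((‖e‖ ^ 2)⁻¹) ^ 8 + 4 * ((‖e‖ ^ 2)⁻¹) ^ 5) * ‖w‖ ^ 2 * ‖e‖ := by
    rw [norm_smul, Real.norm_eq_abs, abs_mul, abs_of_nonneg (sq_nonneg ‖w‖)]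
    gcongr
  have hn3 : ‖((-((‖e + w‖ ^ 2)⁻¹) ^ 7 + ((‖e + w‖ ^ 2)⁻¹) ^ 4) - (-((‖e‖ ^ 2)⁻¹) ^ 7 + ((‖e‖ ^ 2)⁻¹) ^ 4)) • w‖ ≤
      (7 * ((79 / 100 * ‖e‖ ^ 2)⁻¹) ^ 8 + 4 * ((79 / 100 * ‖e‖ ^ 2)⁻¹) ^ 5) * |‖e + w‖ ^ 2 - ‖e‖ ^ 2| * ‖w‖ := by
    rw [norm_smul, Real.norm_eq_abs]
    exact mul_le_mul_of_nonneg_right hD (norm_nonneg _)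
  refine (norm_add₃_le.trans (add_le_add (add_le_add hn1 hn2) hn3)).trans ?_
  exact linearisation_scalar_bound he (norm_nonneg w) hdiff

end Summit.AtomisticToContinuum.Crystallization.Theorems.ExcessDecayLiouville

end
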